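import Literature.NumberTheory.EllipticCurves.Sprung2012.ColemanMaps
import HarnessLib

/-!
# Sprung's ♯/♭ local conditions `E^{♯/♭}_{∞,𝔭}`, the chromatic Selmer groups `Sel^{♯/♭}(E/K_∞)`
# and their Pontryagin duals `X^{♯/♭}(E/K_∞)` (Definitions 7.9 and 7.11; hypothesis structure
# `SharpFlatSelmerDualData`)

Topic `Literature/NumberTheory/EllipticCurves`, cluster `Sprung2012` (namespace = path). Sequel of
`Sprung2012/ColemanMaps.lean` (the pairings `P_{n,x}`, Honda systems, the Coleman characterisation
`IsColemanPair` and the kernels `colemanKer • = Ker Col^•`, with the TRANSCRIPTION CONVENTION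
`H¹_Iw(T) ≅ Hom_ℤ(E(K_∞·K_v), ℤ_p)` at a supersingular prime explained there). A DEFINITION file
transcribing F. E. I. Sprung, *Iwasawa theory for elliptic curves at supersingular primes: A pair of
main conjectures*, J. Number Theory **132** (2012) 1483–1506 [Sprung2012] (held text
`paper:doi-10-1016-j-jnt-2011-11-003`), **Definition 7.9** (p. 1503): "We let `E^♯_{∞,𝔭}` (resp.
`E^♭_{∞,𝔭}`) be the exact annihilator of `Ker Col^♯` (resp. `Ker Col^♭`) under the local Tate
pairing `lim←_n H¹(K_{n,𝔭_n}, T) × lim→_n H¹(K_{n,𝔭_n}, V/T) → ℚ_p/ℤ_p`" (with Lemma 7.10: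
"`E(K_{∞,𝔭}) ⊗ ℚ_p/ℤ_p = lim→_n H¹(K_{n,𝔭_n}, V/T)`" at a supersingular `p`), **Definition 7.11**
(p. 1503): "`Sel^♯(E/K_∞) := Ker( Sel(E/K_∞) → E(K_{∞,𝔭}) ⊗ ℚ_p/ℤ_p / E^♯_{∞,𝔭} )`,
`Sel^♭(E/K_∞) := Ker( Sel(E/K_∞) → E(K_{∞,𝔭}) ⊗ ℚ_p/ℤ_p / E^♭_{∞,𝔭} )`. We also define their
Pontryagin duals `X^*(E/K_∞) := Hom(Sel^*(E/K_∞), ℚ_p/ℤ_p)` for `* ∈ {♯, ♭}`", in the `η = 1` form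
of the introduction (p. 1486: "Let `𝔭` be the prime ideal of `ℚ_∞` above `p`, and `Sel^♯(E/ℚ_∞) :=
Ker( Sel(E/ℚ_∞) → E(ℚ_{∞,𝔭}) ⊗ ℚ_p/ℤ_p / E^♯_{∞,𝔭} )` … The statements here correspond to the
`η = 1` case in the more precise statements of Section 7"), together with the Pontryagin-dual
HYPOTHESIS STRUCTURE `SharpFlatSelmerDualData` (field for field `Kobayashi2003.SignedSelmerDualData`)
carrying `charIdeal` / `mu` / `lambda` — the objects of Thm. 1.2 / 7.14 ("`X^*(E/ℚ_∞)` … is a finitely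
generated torsion `ℤ_p[[X]]`-module"), Thm. 1.4 / 7.16 (Kato divisibility) and Main Conjecture 1.3 /
7.21 ("`Char(X^*(E/ℚ_∞)) = (L^*_p(E,X))`"). VOCABULARY ONLY: definitions with bodies and proved
unfolding lemmas; NOTHING is asserted (no named fact in this file; the facts and the conjecture are NOT
stated here). HONEST FRAMING (cell `bsd-ssimc`, seat `bsd-ssimc-k3c5-kdot-split`, route K3
`SignedLowerHalves`, crux `SprungLowerHalfAtThree` = stmt-BirchSwinnertonDyer-19003; ledger definition
item `defn-SharpFlatSelmerDualData`, BLOCKED `decl-missing:SharpFlatLocalCondition`): this file supplies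
the structure that item asks for; it proves nothing about any curve and moves no census cell; BSD is not
proved by any of this.

Under the convention of `ColemanMaps.lean` (`z ∈ H¹_Iw(T)` ↔ the functional `x ↦ (x, z)` on
`E(K_∞·K_v)`; the local Tate pairing of the Kummer class of `x ⊗ p^{-k}` with `z` is
`z(x)/pᵏ mod ℤ_p`), "`t ∈ E^•_{∞,𝔭}`" for `t = x ⊗ p^{-k}` reads "`z(x) ∈ pᵏ ℤ_p` for every
`z ∈ Ker Col^•`", which is `sharpFlatLocalKummerOverOfEmb` below — the exact shape of
`Kobayashi2003.localKummerOverOfEmb` (Kummer cocycles `τ ↦ τQ − Q`, `pᵏQ = x`) with the divisibility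
clause added. Kobayashi's explicit `E^±(K_{n,𝔭})` play no role: "One of the insights in [Kobayashi] was to
describe the `E^±(K_{n,𝔭})` explicitly using trace maps. If one could explicitly write
`E^{♯/♭}_{∞,𝔭} = lim→_n E^{♯/♭}(K_{n,𝔭}) ⊗ ℚ_p/ℤ_p` for some easily defined `E^{♯/♭}(K_{n,𝔭})`, this
should lead to some interesting applications" (Open Problem 7.22, p. 1505).

## Contents

* `sharpFlatLocalKummerOverOfEmb W p H ι M 𝒦` — the Kummer classes `[x ⊗ p^{-k}]`, `x ∈ M`, with
  `z(x) ∈ pᵏ ℤ_p` for all `z ∈ 𝒦` (the exact annihilator of a set `𝒦` of functionals on `M`);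
  for `𝒦 = Ker Col^•`, `M = E(K_∞·K_v)` this is Def. 7.9's `E^•_{∞,𝔭}` as a local condition on
  `H¹(K_∞, E[p^∞])`; it refines the classical Kummer condition
  (`sharpFlatLocalKummerOverOfEmb_le_localKummerOverOfEmb`);
* `sharpFlatSelmerInfty W κ ι ap g c • = Sel^•(E/K_∞)` (Def. 7.11 / p. 1486: the classical
  `Sel_{p^∞}(E/K_∞) = W.selmerInfty κ` cut by the •-condition at the place singled out by `ι` and all
  its conjugates), `≤ W.selmerInfty κ`, stable under the conjugation action of `Γ_K`
  (`conjH1_mem_sharpFlatSelmerInfty`);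
* `SharpFlatSelmerDualData W κ γ ι ap g c •` = `X^•(E/K_∞)` with its `Λ = ℤ_p⟦T⟧`-structure
  (`T = γ − 1`) as a hypothesis structure; `charIdeal`, `mu`, `lambda`, `toDualEquiv`
  (generic API such as `eq_zero_iff_toDual_eq_zero` is not duplicated: argue with `D.bijective`).
Intended instance: `K = ℚ`, `κ` cyclotomic, `K_v = ℚ_p` (ONE place of `ℚ_∞` above `p`;
TODO(general form): several places above `p`), `ap = a_p(E)`, `g` a local lift of the normalised
generator `γ`, `c` a Honda system (`Sprung2012.IsHondaSystem`). Not here: existence of the dual datum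
(a construction, as `Kobayashi2003.nonempty_signedSelmerDualData`), Thm. 7.14, Thm. 7.16, Prop. 7.19,
Main Conj. 7.21, Sprung 2024 §5.2 (the ♯/♭ Euler characteristic) — sibling files.

## References
* [Sprung2012] F. E. I. Sprung, J. Number Theory 132 (2012) 1483–1506: §1 p. 1486 (Thm. 1.2,
  Main Conj. 1.3, Thm. 1.4); Def. 7.9, Lemma 7.10, Def. 7.11 (p. 1503); Thm. 7.14, Thm. 7.16
  (p. 1504); Prop. 7.19, Main Conj. 7.21, Open Problem 7.22 (p. 1505).
* [Kobayashi2003] S. Kobayashi, Invent. Math. 152 (2003), Def. 1.1 and p. 2 ("`ℤ_p[[Γ]]` acts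
  naturally on the Pontryagin dual").
* [GreenbergLNM1716] R. Greenberg, LNM 1716 (1999), §1 p. 60 (the `Λ`-action, `T = γ − 1`).
-/

noncomputable section

open scoped Classical

open NumberField IsDedekindDomain Polynomial

universe u

namespace Literature.NumberTheory.EllipticCurves.Sprung2012

open Literature.NumberTheory.EllipticCurves Literature.NumberTheory.GaloisRepresentations ZpExtension
  Literature.NumberTheory.EllipticCurves.Kobayashi2003 Literature.NumberTheory.EllipticCurves.Sprung2017


/-! ### The local condition `E^•_{∞,𝔭}`: Kummer classes annihilated by `Ker Col^•` (Def. 7.9) -/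

section Kummer

variable {K : Type u} [Field K] (W : WeierstrassCurve K) (p : ℕ) [Fact p.Prime]
  (H : Subgroup (Field.absoluteGaloisGroup K))
variable {E : Type u} [Field E] [Algebra K E] (ι : AlgebraicClosure K →ₐ[K] AlgebraicClosure E)

/-- **The Kummer classes annihilated by a set of functionals** — Def. 7.9 ("We let `E^♯_{∞,𝔭}`
(resp. `E^♭_{∞,𝔭}`) be the exact annihilator of `Ker Col^♯` (resp. `Ker Col^♭`) under the local
Tate pairing `lim← H¹(K_{n,𝔭_n}, T) × lim→ H¹(K_{n,𝔭_n}, V/T) → ℚ_p/ℤ_p`") under the convention of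
the module docstring, in the shape of `Kobayashi2003.localKummerOverOfEmb`: for `H ≤ Γ_K` with fixed
field `L` (meant: `H = ker κ`, `L = K_∞`), an embedding `ι` (the place `w ∣ v` of `L`), a subgroup
`M` of `E(K̄_v)` (meant: `E(L_w) = localTowerPointsOfEmb κ ι W`) and a set `𝒦` of functionals
`M →+ ℤ_p` (meant: `Ker Col^•`), the classes `c ∈ H¹(H, E[p^∞])` whose restriction to
`Gal(K̄_v/L_w)` is the Kummer cocycle `τ ↦ τQ − Q` of some `Q ∈ E(K̄_v)` with `x = pᵏQ ∈ M` — the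
class of `x ⊗ p^{-k}` — such that `z(x) ∈ pᵏ ℤ_p` for every `z ∈ 𝒦` (the local Tate pairing of
`x ⊗ p^{-k}` with `z` is `z(x)/pᵏ mod ℤ_p`). An additive subgroup (closed under sum: from
`(Q₁, k₁)`, `(Q₂, k₂)` pass to `(Q₁ + Q₂, k₁ + k₂)`). For `𝒦 = ∅` or `{0}` this is the full Kummer
condition `localKummerOverOfEmb W p H ι M`. [cite: Sprung2012, Def. 7.9 and Def. 7.11 (p. 1503)] -/
def sharpFlatLocalKummerOverOfEmb (M : AddSubgroup (localPoints W E)) (𝒦 : Set (M →+ ℤ_[p])) :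
    AddSubgroup (W.subgroupH1 p H) where
  carrier := {c | ∃ (φ : contOneCocycles.{0, u} (discreteTopRep H (W.geomPrimaryTorsion p)))
      (Q : localPoints W E) (k : ℕ) (hQ : (p ^ k) • Q ∈ M),
      oneCocycleClass (discreteTopRep H (W.geomPrimaryTorsion p)) φ = c ∧
      (∀ z ∈ 𝒦, (p : ℤ_[p]) ^ k ∣ z ⟨(p ^ k) • Q, hQ⟩) ∧
      ∀ τ : localSubgroupOfEmb H ι,
        pointsMapOfEmb W ι ((φ.1 (resGalSubgroupOfEmb H ι τ) : W.geomPrimaryTorsion p) :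
            W.geomPoints) = (τ : Field.absoluteGaloisGroup E) • Q - Q}
  zero_mem' := ⟨0, 0, 0, by rw [smul_zero]; exact zero_mem M, oneCocycleClass_zero _,
    fun z _ => by rw [pow_zero]; exact one_dvd _,
    fun τ => by simp⟩
  add_mem' := by
    rintro c₁ c₂ ⟨φ₁, Q₁, k₁, hM₁, rfl, hK₁, h₁⟩ ⟨φ₂, Q₂, k₂, hM₂, rfl, hK₂, h₂⟩
    have hM : (p ^ (k₁ + k₂)) • (Q₁ + Q₂) ∈ M := by
      rw [smul_add]
      refine add_mem ?_ ?_
      · rw [pow_add, mul_comm, ← smul_smul]; exact AddSubgroup.nsmul_mem M hM₁ _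
      · rw [pow_add, ← smul_smul]; exact AddSubgroup.nsmul_mem M hM₂ _
    refine ⟨φ₁ + φ₂, Q₁ + Q₂, k₁ + k₂, hM, oneCocycleClass_add _ φ₁ φ₂, fun z hz => ?_, fun τ => ?_⟩
    · have hx : (⟨(p ^ (k₁ + k₂)) • (Q₁ + Q₂), hM⟩ : M) =
          (p ^ k₂) • (⟨(p ^ k₁) • Q₁, hM₁⟩ : M) + (p ^ k₁) • (⟨(p ^ k₂) • Q₂, hM₂⟩ : M) := by
        apply Subtype.ext
        show (p ^ (k₁ + k₂)) • (Q₁ + Q₂) = (p ^ k₂) • ((p ^ k₁) • Q₁) + (p ^ k₁) • ((p ^ k₂) • Q₂)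
        rw [smul_smul, smul_smul, ← pow_add, ← pow_add, add_comm k₂ k₁, smul_add]
      rw [hx, map_add, map_nsmul, map_nsmul, pow_add]
      refine dvd_add ?_ ?_
      · rw [nsmul_eq_mul, Nat.cast_pow, mul_comm ((p : ℤ_[p]) ^ k₁)]
        exact mul_dvd_mul_left _ (hK₁ z hz)
      · rw [nsmul_eq_mul, Nat.cast_pow]
        exact mul_dvd_mul_left _ (hK₂ z hz)
    · rw [Submodule.coe_add, ContinuousMap.add_apply, AddSubgroup.coe_add, map_add, h₁ τ, h₂ τ,
        smul_add]
      abel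
  neg_mem' := by
    rintro c ⟨φ, Q, k, hM, rfl, hK, h⟩
    have hM' : (p ^ k) • (-Q) ∈ M := by rw [smul_neg]; exact neg_mem hM
    refine ⟨-φ, -Q, k, hM', ?_, fun z hz => ?_, fun τ => ?_⟩
    · rw [← oneCocycleClassₗ_apply, map_neg, oneCocycleClassₗ_apply]
    · have hx : (⟨(p ^ k) • (-Q), hM'⟩ : M) = -⟨(p ^ k) • Q, hM⟩ :=
        Subtype.ext (smul_neg _ _)
      rw [hx, map_neg]
      exact (dvd_neg).2 (hK z hz)
    · rw [Submodule.coe_neg, ContinuousMap.neg_apply, AddSubgroup.coe_neg, map_neg, h τ, smul_neg]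
      abel

variable {W p H ι}

/-- Membership in the annihilator condition (unfolding). [cite: Sprung2012, Def. 7.9 (p. 1503) (unfolding)] -/
theorem mem_sharpFlatLocalKummerOverOfEmb_iff (M : AddSubgroup (localPoints W E))
    (𝒦 : Set (M →+ ℤ_[p])) (c : W.subgroupH1 p H) :
    c ∈ sharpFlatLocalKummerOverOfEmb W p H ι M 𝒦 ↔
      ∃ (φ : contOneCocycles.{0, u} (discreteTopRep H (W.geomPrimaryTorsion p)))
        (Q : localPoints W E) (k : ℕ) (hQ : (p ^ k) • Q ∈ M),
        oneCocycleClass (discreteTopRep H (W.geomPrimaryTorsion p)) φ = c ∧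
        (∀ z ∈ 𝒦, (p : ℤ_[p]) ^ k ∣ z ⟨(p ^ k) • Q, hQ⟩) ∧
        ∀ τ : localSubgroupOfEmb H ι,
          pointsMapOfEmb W ι ((φ.1 (resGalSubgroupOfEmb H ι τ) : W.geomPrimaryTorsion p) :
            W.geomPoints) = (τ : Field.absoluteGaloisGroup E) • Q - Q :=
  Iff.rfl

/-- The annihilator condition is antitone in the set of functionals `𝒦`.
[cite: Sprung2012, Def. 7.9 (p. 1503) (unfolding)] -/
theorem sharpFlatLocalKummerOverOfEmb_antitone (M : AddSubgroup (localPoints W E))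
    {𝒦 𝒦' : Set (M →+ ℤ_[p])} (h : 𝒦 ⊆ 𝒦') :
    sharpFlatLocalKummerOverOfEmb W p H ι M 𝒦' ≤ sharpFlatLocalKummerOverOfEmb W p H ι M 𝒦 := by
  rintro c ⟨φ, Q, k, hM, hc, hK, hτ⟩
  exact ⟨φ, Q, k, hM, hc, fun z hz => hK z (h hz), hτ⟩

/-- **The •-condition refines the Kummer condition of `M`**: forgetting the divisibility clause,
every class in `sharpFlatLocalKummerOverOfEmb W p H ι M 𝒦` lies in
`Kobayashi2003.localKummerOverOfEmb W p H ι M` (the image of `M ⊗ ℚ_p/ℤ_p`), hence in the tree's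
classical local kernel (`localKummerOverOfEmb_le_localKerOverOfEmb`); so `Sel^• ⊆ Sel`.
[cite: Sprung2012, Def. 7.11 (p. 1503)] -/
theorem sharpFlatLocalKummerOverOfEmb_le_localKummerOverOfEmb (M : AddSubgroup (localPoints W E))
    (𝒦 : Set (M →+ ℤ_[p])) :
    sharpFlatLocalKummerOverOfEmb W p H ι M 𝒦 ≤ localKummerOverOfEmb W p H ι M := by
  rintro c ⟨φ, Q, k, hM, hc, -, hτ⟩
  exact ⟨φ, Q, k, hc, hM, hτ⟩

end Kummer

/-! ### `Sel^•(E/K_∞)` and its Pontryagin dual `X^•(E/K_∞)` -/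

section Selmer

variable {K : Type u} [Field K] [NumberField K] (W : WeierstrassCurve K) {p : ℕ} [Fact p.Prime]
  (κ : ZpExtension K p)
variable {E : Type u} [Field E] [Algebra K E] (ι : AlgebraicClosure K →ₐ[K] AlgebraicClosure E)

/-- **Sprung's `Sel^•(E/K_∞)`** (`• ∈ {♯, ♭}`), Definition 7.11 / p. 1486:
"`Sel^♯(E/K_∞) := Ker( Sel(E/K_∞) → E(K_{∞,𝔭}) ⊗ ℚ_p/ℤ_p / E^♯_{∞,𝔭} )`" — the classical
`Sel_{p^∞}(E/K_∞)` (`W.selmerInfty κ ⊆ H¹(K_∞, E[p^∞])`) cut down, at the place `w` of `K_∞` singled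
out by `ι` (over the place `v` of `K` with completion `E = K_v`) and at all its conjugates
`conj_σ`, `σ ∈ Γ_K` (as `Kobayashi2003.signedSelmerLayer` does), to the classes whose local
restriction lies in `E^•_{∞,w}` = the Kummer classes of `E(K_∞·K_v)` annihilated by `Ker Col^•`
(`sharpFlatLocalKummerOverOfEmb` with `𝒦 = colemanKer`). Data: `ap` (`= a_p(E)`), `g ∈ Γ_{K_v}`
(a local lift of the chosen generator), `c` (a Honda system). Intended: `K = ℚ`, `v = p` (ONE place
of `ℚ_∞` above `p`); TODO(general form): several places above `p`.
[cite: Sprung2012, Def. 7.11 (p. 1503) and §1 p. 1486] -/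
def sharpFlatSelmerInfty (ap : ℤ) (g : Field.absoluteGaloisGroup E) (c : ℕ → localPoints W E)
    (col : Chroma) : AddSubgroup (W.subgroupH1 p κ.kerSubgroup) :=
  W.selmerInfty κ ⊓
    ⨅ σ : Field.absoluteGaloisGroup K,
      (sharpFlatLocalKummerOverOfEmb W p κ.kerSubgroup ι (localTowerPointsOfEmb κ ι W)
          (colemanKer κ ι W ap g c col)).comap
        (W.conjH1 p κ.kerSubgroup σ)

/-- Membership in `Sel^•(E/K_∞)`. [cite: Sprung2012, Def. 7.11 (p. 1503) (unfolding)] -/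
theorem mem_sharpFlatSelmerInfty_iff (ap : ℤ) (g : Field.absoluteGaloisGroup E)
    (c : ℕ → localPoints W E) (col : Chroma) (s : W.subgroupH1 p κ.kerSubgroup) :
    s ∈ sharpFlatSelmerInfty W κ ι ap g c col ↔ s ∈ W.selmerInfty κ ∧
      ∀ σ : Field.absoluteGaloisGroup K, W.conjH1 p κ.kerSubgroup σ s ∈
        sharpFlatLocalKummerOverOfEmb W p κ.kerSubgroup ι (localTowerPointsOfEmb κ ι W)
          (colemanKer κ ι W ap g c col) := by
  simp only [sharpFlatSelmerInfty, AddSubgroup.mem_inf, AddSubgroup.mem_iInf, AddSubgroup.mem_comap]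

/-- **`Sel^•(E/K_∞) ≤ Sel_{p^∞}(E/K_∞)`** (it is cut out of it). [cite: Sprung2012, Def. 7.11 (p. 1503)] -/
theorem sharpFlatSelmerInfty_le_selmerInfty (ap : ℤ) (g : Field.absoluteGaloisGroup E)
    (c : ℕ → localPoints W E) (col : Chroma) :
    sharpFlatSelmerInfty W κ ι ap g c col ≤ W.selmerInfty κ :=
  inf_le_left

/-- **`Sel^•(E/K_∞)` is stable under the conjugation action of `Γ_K`** on `H¹(K_∞, E[p^∞])` — the
action through which `Λ` acts on the Pontryagin dual (the classical part by
`map_conjH1_selmerGroupOver_le_holds`, the •-conditions because `conj_σ ∘ conj_γ = conj_{σγ}`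
permutes them, `conjH1_mul_holds`); discharges the field `conj_mem` of `SharpFlatSelmerDualData`.
[cite: Sprung2012, Def. 7.11 (p. 1503)] -/
theorem conjH1_mem_sharpFlatSelmerInfty (ap : ℤ) (g : Field.absoluteGaloisGroup E)
    (c : ℕ → localPoints W E) (col : Chroma) (γ : Field.absoluteGaloisGroup K)
    {s : W.subgroupH1 p κ.kerSubgroup} (hs : s ∈ sharpFlatSelmerInfty W κ ι ap g c col) :
    W.conjH1 p κ.kerSubgroup γ s ∈ sharpFlatSelmerInfty W κ ι ap g c col := by
  rw [mem_sharpFlatSelmerInfty_iff] at hs ⊢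
  refine ⟨W.map_conjH1_selmerGroupOver_le_holds p κ.kerSubgroup γ ⟨s, hs.1, rfl⟩, fun σ => ?_⟩
  rw [← AddMonoidHom.comp_apply, ← conjH1_mul_holds κ.kerSubgroup (W.geomPrimaryTorsion p) σ γ]
  exact hs.2 (σ * γ)

end Selmer

/-! ### The Pontryagin dual `X^•(E/K_∞)` as a hypothesis structure -/

section Dual

variable {K : Type u} [Field K] [NumberField K] {p : ℕ} [Fact p.Prime]

/-- **Pontryagin-dual data for `Sel^•(E/K_∞)`** — `X^•(E/K_∞) := Hom(Sel^•(E/K_∞), ℚ_p/ℤ_p)`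
(Def. 7.11: "We also define their Pontryagin duals `X^*(E/K_∞) := Hom(Sel^*(E/K_∞), ℚ_p/ℤ_p)` for
`* ∈ {♯, ♭}`"; Thm. 1.2: "a finitely generated torsion `ℤ_p[[X]]`-module") as an abstract
`Λ = ℤ_p⟦T⟧`-module `X`, FIELD FOR FIELD `Kobayashi2003.SignedSelmerDualData` with
`signedSelmerInfty ↦ sharpFlatSelmerInfty`: `conj_mem` (stability under `conj_γ`, dischargeable by
`conjH1_mem_sharpFlatSelmerInfty`), `toDual` bijective onto `Hom(Sel^•_∞, ℚ/ℤ)`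
(`ℚ/ℤ = AddCircle (1 : ℚ) ⊇ ℚ_p/ℤ_p`), `toDual_T_smul` (`T = γ − 1`, "identify `Λ = ℤ_p[[G_∞]]` with
`ℤ_p[Δ][[X]]` by sending `γ` to `1 + X`", §2 p. 1486), `toDual_C_smul` (constants through `ℤ_p →
ℤ/pᵏ`). NOTHING about existence, finite generation, torsion (Thm. 7.14) or the main conjecture is
asserted; statements consume a datum `D` as a hypothesis. This is the structure the ledger item
`defn-SharpFlatSelmerDualData` asks for. [cite: Sprung2012, Def. 7.11 (p. 1503) and Thm. 1.2 (p. 1486) (the object only)] -/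
structure SharpFlatSelmerDualData (W : WeierstrassCurve K) (κ : ZpExtension K p)
    (γ : Field.absoluteGaloisGroup K) {E : Type u} [Field E] [Algebra K E]
    (ι : AlgebraicClosure K →ₐ[K] AlgebraicClosure E) (ap : ℤ) (g : Field.absoluteGaloisGroup E)
    (c : ℕ → localPoints W E) (col : Chroma) where
  /-- The underlying type of the Iwasawa module `X^•(E/K_∞)`. -/
  X : Type u
  /-- `X` is an abelian group. -/
  [addCommGroup : AddCommGroup X]
  /-- `X` is a `Λ = ℤ_p⟦T⟧`-module. -/
  [module : Module (IwasawaAlgebra p) X]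
  /-- `Sel^•(E/K_∞)` is stable under conjugation by `γ` (hypothesis field; holds by
  `conjH1_mem_sharpFlatSelmerInfty`). -/
  conj_mem : ∀ s ∈ sharpFlatSelmerInfty W κ ι ap g c col,
    W.conjH1 p κ.kerSubgroup γ s ∈ sharpFlatSelmerInfty W κ ι ap g c col
  /-- The identification of `X` with the character group `Hom(Sel^•_∞, ℚ/ℤ)`. -/
  toDual : X →+ (sharpFlatSelmerInfty W κ ι ap g c col →+ AddCircle (1 : ℚ))
  /-- `toDual` is a group isomorphism. -/
  bijective : Function.Bijective toDual
  /-- `T` acts as `γ - 1`: `(T·x)(s) = x(conj_γ s) - x(s)`. -/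
  toDual_T_smul : ∀ (x : X) (s : sharpFlatSelmerInfty W κ ι ap g c col),
    toDual ((PowerSeries.X : IwasawaAlgebra p) • x) s =
      toDual x ⟨W.conjH1 p κ.kerSubgroup γ s, conj_mem s s.2⟩ - toDual x s
  /-- Constants `c ∈ ℤ_p` act on `pᵏ`-torsion classes through `ℤ_p → ℤ/pᵏ`. -/
  toDual_C_smul : ∀ (a : ℤ_[p]) (x : X) (s : sharpFlatSelmerInfty W κ ι ap g c col) (k : ℕ),
    (p ^ k) • s = 0 → toDual (PowerSeries.C a • x) s = (PadicInt.toZModPow k a).val • toDual x s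

namespace SharpFlatSelmerDualData

variable {W : WeierstrassCurve K} {κ : ZpExtension K p} {γ : Field.absoluteGaloisGroup K}
  {E : Type u} [Field E] [Algebra K E] {ι : AlgebraicClosure K →ₐ[K] AlgebraicClosure E} {ap : ℤ}
  {g : Field.absoluteGaloisGroup E} {c : ℕ → localPoints W E} {col : Chroma}

-- The structure projections `addCommGroup`, `module` as instances on the NEW type `D.X` (exactly as
-- `Kobayashi2003.SignedSelmerDualData`, `TowerSignedSelmerDualData` do; no library instance is touched).
attribute [instance] SharpFlatSelmerDualData.addCommGroup SharpFlatSelmerDualData.module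

variable (D : SharpFlatSelmerDualData W κ γ ι ap g c col)

/-- The **characteristic ideal** `Char(X^•(E/K_∞)) ⊆ Λ` (`Module.charIdeal`); a generator is a
characteristic power series of the •-Selmer group — the object of Main Conjecture 7.21 / 1.3
("`Char(X^*(E/ℚ_∞)) = (L^*_p(E,X))`", p. 1486; NOT asserted).
[cite: Sprung2012, Main Conj. 1.3 / 7.21 and Thm. 7.14 (the object only)] -/
def charIdeal : Ideal (IwasawaAlgebra p) :=
  Literature.NumberTheory.EllipticCurves.Module.charIdeal (IwasawaAlgebra p) D.X

/-- The **`μ`-invariant** of `X^•(E/K_∞)` (`muInvariant`; junk `0` unless finitely generated torsion).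
[cite: Sprung2012, Thm. 7.14 (the invariants only)] -/
def mu : ℕ :=
  muInvariant p D.X

/-- The **`λ`-invariant** of `X^•(E/K_∞)` (`lambdaInvariant`; junk `0` unless finitely generated
torsion). [cite: Sprung2012, Thm. 7.14 (the invariants only)] -/
def lambda : ℕ :=
  lambdaInvariant p D.X

/-- `toDual` as a group isomorphism `X ≃ Hom(Sel^•(E/K_∞), ℚ/ℤ)`.
[cite: Sprung2012, Def. 7.11 (p. 1503) (the object only)] -/
def toDualEquiv : D.X ≃+ (sharpFlatSelmerInfty W κ ι ap g c col →+ AddCircle (1 : ℚ)) :=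
  AddEquiv.ofBijective D.toDual D.bijective

end SharpFlatSelmerDualData

end Dual

end Literature.NumberTheory.EllipticCurves.Sprung2012

end
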